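import Literature.NumberTheory.Transcendental.AnalytificationProjProofs
import HarnessLib

/-!
# Complex points and homogeneous coordinates of an embedded projective `ℂ`-scheme

Family `hodge`, layer `Literature/AlgebraicGeometry/HodgeTheory`; GAGA bookkeeping for the
decomposition of `Hartshorne1977_hypersurface_exists_holomorphicTopForm`
(files `HypersurfaceHolomorphicForms`, `HypersurfaceGeometricGenus`). For a closed immersion
`ι : Y ⟶ ℙ^{n+1}_ℂ` over `ℂ` with image the zero set `V₊(F)` of a homogeneous form `F`, we compare
the complex points `Y(ℂ)` (strong topology, `Motives.ComplexPoints`) with the projective zero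
locus `{[z] | F(z) = 0}` inside Mathlib's projectivization `ℙ ℂ ℂ^{n+2}` (analytic topology and
standard atlas of `Literature/NumberTheory/Transcendental/ProjectiveSpace`), through the
comparison homeomorphism `projPoint : ℙ ℂ ℂ^{n+2} → ℙ^{n+1}_ℂ(ℂ)` of
`Literature/NumberTheory/Transcendental/AnalytificationProjProofs` (`ℙⁿ(ℂ) = (ℙⁿ_ℂ)^h`,
Serre GAGA §2 n°5). Everything here is PROVED:

* `Motives.AlgPoints.isEmbedding_map_of_isClosedImmersion`: a closed immersion of `k`-schemes
  induces a topological embedding `X(L) → Y(L)` of `L`-points (regular functions on `X` lift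
  locally to `Y` along a closed immersion into an affine open, Mathlib `Scheme.Hom.app_surjective`);
* `hypersurfacePoint ι = projPoint⁻¹ ∘ ι(ℂ) : Y(ℂ) → ℙ ℂ ℂ^{n+2}` is an embedding
  (`isEmbedding_hypersurfacePoint`) with image `{[z] | F(z) = 0}` (`range_hypersurfacePoint`:
  complex points of `Y` are the closed points of `V₊(F)`, Nullstellensatz via
  `Motives.ComplexPoints.equivClosedPoints`);
* the complex points of the affine open `ι⁻¹(D₊(X_i))` (`hypersurfaceAffineChart ι i`) are the
  preimage of the standard chart domain `U_i = {z_i ≠ 0}` (`setOf_mem_hypersurfaceAffineChart`),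
  and the affine coordinate `z_k/z_i` of `hypersurfacePoint ι P` is the value at `P` of the regular
  function `ι^*(X_k/X_i)` (`hypersurfaceCoordFn`, `evalOrZero_hypersurfaceCoordFn`);
* `hypersurface_complexPoints`: the three statements packaged as consumed by the residue-form
  reduction (file `HypersurfaceResidueForms`).

This is Serre's description of `Y^h ⊂ ℙ^{n+1}(ℂ)` for a closed subvariety (GAGA §2 n°5: the
algebraic charts `D₊(X_i) ≅ 𝔸^{n+1}` are analytic charts, Z-closed subsets are analytic, regular
functions are holomorphic), on the tree's carriers.

## References

* J.-P. Serre, *Géométrie algébrique et géométrie analytique*, Ann. Inst. Fourier 6 (1956), §2 n°5.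
* D. Mumford, *The Red Book of Varieties and Schemes*, I §10.
* R. Hartshorne, *Algebraic Geometry* (1977), II §2 (Proj), Ex. 2.14, II §5.
-/

noncomputable section

open scoped Topology LinearAlgebra.Projectivization
open Set AlgebraicGeometry CategoryTheory Topology Opposite

/-! ### Closed immersions embed `L`-points -/

namespace Literature.AlgebraicGeometry.Motives

variable {k : Type} [Field k] {X Y : SchemeOver k} {L : Type} [Field L] [Algebra k L]

/-- Evaluation at an `L`-point commutes with restriction along any morphism of opens `i : W ⟶ U`
(a restatement of `AlgPoints.eval_map_homOfLE`, with which it agrees definitionally, usable for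
`eqToHom`s). [folklore] -/
theorem AlgPoints.eval_presheaf_map (P : AlgPoints X L) {U W : X.left.Opens} (i : W ⟶ U)
    (hW : P.pt ∈ W) (f : Γ(X.left, U)) :
    P.eval W hW (X.left.presheaf.map i.op f) = P.eval U (i.le hW) f :=
  AlgPoints.eval_map_homOfLE i.le f hW

variable [TopologicalSpace L]

/-- **A closed immersion induces an embedding on `L`-points.** For a closed `k`-immersion
`φ : X ⟶ Y`, the map `X(L) → Y(L)` is injective (`φ` is a monomorphism) and the strong topology
of `X(L)` is induced from `Y(L)`: a sub-basic open `{P ∈ U(L) | f(P) ∈ V}` of `X(L)` is, near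
each of its points, the preimage of `{Q ∈ D(L) | g(Q) ∈ V}` for an affine open `D ⊆ Y` with
`φ⁻¹(D) ⊆ U` and a lift `g ∈ Γ(Y, D)` of `f|_{φ⁻¹(D)}` (closed immersions are surjective on
sections over affine opens, Mathlib `Scheme.Hom.app_surjective`). Compare
`AlgPoints.isEmbedding_map` for open immersions. [Serre, GAGA §2 n°5 Lemme 1 b); Mumford,
*Red Book* I §10] [folklore] -/
theorem AlgPoints.isEmbedding_map_of_isClosedImmersion (φ : X ⟶ Y) [IsClosedImmersion φ.left] :
    IsEmbedding (AlgPoints.map φ : AlgPoints X L → AlgPoints Y L) := by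
  refine ⟨⟨le_antisymm (AlgPoints.continuous_map φ).le_induced (le_generateFrom ?_)⟩,
    fun P Q h ↦ ?_⟩
  · rintro _ ⟨U, f, V, hV, rfl⟩
    refine @isOpen_iff_forall_mem_open _ (TopologicalSpace.induced (AlgPoints.map φ)
      AlgPoints.instTopologicalSpace) _ |>.mpr fun P hP ↦ ?_
    obtain ⟨hPU, hPV⟩ := hP
    -- `U = φ⁻¹(U₀)` for an open `U₀` of `Y`, as `φ` is a (closed) embedding
    obtain ⟨U₀, hU₀, hUU₀⟩ := φ.left.isClosedEmbedding.isInducing.isOpen_iff.mp U.isOpen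
    -- an affine open `D ∋ φ(P)` inside `U₀`
    obtain ⟨D, hD, hxD, hDU₀⟩ := (TopologicalSpace.Opens.isBasis_iff_nbhd.mp
      Y.left.isBasis_affineOpens) (show φ.left.base P.pt ∈ (⟨U₀, hU₀⟩ : Y.left.Opens) from by
        change P.pt ∈ φ.left.base ⁻¹' U₀
        rw [hUU₀]; exact hPU)
    have hWU : φ.left ⁻¹ᵁ D ≤ U := by
      intro x hx
      have : x ∈ φ.left.base ⁻¹' U₀ := hDU₀ hx
      rwa [hUU₀] at this
    -- lift `f|_{φ⁻¹ D}` to a section `g` over `D`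
    obtain ⟨g, hg⟩ := φ.left.app_surjective D hD (X.left.presheaf.map (homOfLE hWU).op f)
    refine ⟨AlgPoints.map φ ⁻¹' AlgPoints.basicSet D g V, ?_, isOpen_induced
      (AlgPoints.isOpen_basicSet D g hV), ?_⟩
    · rintro Q ⟨hQD, hQV⟩
      refine ⟨hWU hQD, ?_⟩
      rw [AlgPoints.eval_map, hg, AlgPoints.eval_map_homOfLE] at hQV
      exact hQV
    · refine ⟨hxD, ?_⟩
      rw [AlgPoints.eval_map, hg, AlgPoints.eval_map_homOfLE]
      exact hPV
  · have h' : P.left ≫ φ.left = Q.left ≫ φ.left := by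
      rw [← Over.comp_left, ← Over.comp_left]
      exact congrArg CommaMorphism.left h
    exact Over.OverMorphism.ext ((cancel_mono φ.left).mp h')

end Literature.AlgebraicGeometry.Motives

/-! ### The chart domain `Uᵢ` as the complement of `V(Xᵢ)` -/

namespace Projectivization

/-- In `ℙ 𝕜 𝕜^{n+1}`, the complement of the projective zero locus of the coordinate `Xᵢ` is the
domain `Uᵢ = {zᵢ ≠ 0}` of the `i`-th standard chart (a dot-notation extension of the tree's API on
Mathlib's `Projectivization`, file `ProjectiveSpace`). [folklore] -/
theorem compl_projZeroLocus_X_eq_stdChartSource {𝕜 : Type*} [Field 𝕜] {n : ℕ} (i : Fin (n + 1)) :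
    (projZeroLocus {(MvPolynomial.X i : MvPolynomial (Fin (n + 1)) 𝕜)})ᶜ = stdChartSource i := by
  ext p
  induction p using Projectivization.ind with | h v hv => ?_
  rw [mem_compl_iff, mk_mem_stdChartSource_iff,
    mem_projZeroLocus_mk_iff (by rintro G rfl; simpa using MvPolynomial.isHomogeneous_X 𝕜 i)]
  simp

end Projectivization

namespace Literature.AlgebraicGeometry.HodgeTheory

open Literature.NumberTheory.Transcendental

attribute [local instance] MvPolynomial.gradedAlgebra

variable {n : ℕ} {Y : Motives.SchemeOver ℂ}

/-- The grading of `ℂ[X₀, …, X_{n+1}]` by degree (local notation; `ℙ^{n+1}_ℂ = Proj 𝓐`), as in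
`AnalytificationProjProofs`. [folklore] -/
local notation "𝓐" => MvPolynomial.homogeneousSubmodule (Fin (n + 2)) ℂ

/-! ### The homogeneous-coordinate map of an embedded scheme -/

/-- The **homogeneous-coordinate map of an embedded `ℂ`-scheme**: for `ι : Y ⟶ ℙ^{n+1}_ℂ`, the
complex point `P ∈ Y(ℂ)` is sent to the point `[z] ∈ ℙ ℂ ℂ^{n+2}` (Mathlib's projectivization with
the analytic topology and standard atlas of `Literature/NumberTheory/Transcendental/ProjectiveSpace`)
whose comparison point `projPoint (n+1) [z] ∈ ℙ^{n+1}_ℂ(ℂ)` is `ι(P)`, i.e.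
`projPoint⁻¹ ∘ ι(ℂ)` through the homeomorphism `isHomeomorph_projPoint` (`ℙⁿ(ℂ) = (ℙⁿ_ℂ)^h`,
Serre GAGA §2 n°5). [cite: SerreGAGA1956, §2 n°5 Prop. 2] -/
def hypersurfacePoint (ι : Y ⟶ Motives.projectiveSpace (n + 1) ℂ) :
    Motives.ComplexPoints Y → ℙ ℂ (Fin (n + 2) → ℂ) := fun P ↦
  ((isHomeomorph_projPoint (n + 1)).homeomorph (projPoint (n + 1))).symm (Motives.AlgPoints.map ι P)

/-- Defining property of `hypersurfacePoint`: its comparison point is `ι(P)`. [folklore] -/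
@[simp]
theorem projPoint_hypersurfacePoint (ι : Y ⟶ Motives.projectiveSpace (n + 1) ℂ)
    (P : Motives.ComplexPoints Y) :
    projPoint (n + 1) (hypersurfacePoint ι P) = Motives.AlgPoints.map ι P :=
  ((isHomeomorph_projPoint (n + 1)).homeomorph (projPoint (n + 1))).apply_symm_apply _

/-- `hypersurfacePoint ι P` is the unique `p` with `projPoint p = ι(P)`. [folklore] -/
theorem hypersurfacePoint_eq_of_projPoint_eq (ι : Y ⟶ Motives.projectiveSpace (n + 1) ℂ)
    (P : Motives.ComplexPoints Y) {p : ℙ ℂ (Fin (n + 2) → ℂ)}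
    (h : projPoint (n + 1) p = Motives.AlgPoints.map ι P) : hypersurfacePoint ι P = p :=
  projPoint_injective (n + 1) (by rw [projPoint_hypersurfacePoint, h])

/-- `hypersurfacePoint ι` is continuous (`ι(ℂ)` is continuous, `projPoint` a homeomorphism).
[folklore] -/
theorem continuous_hypersurfacePoint (ι : Y ⟶ Motives.projectiveSpace (n + 1) ℂ) :
    Continuous (hypersurfacePoint ι) :=
  (Homeomorph.continuous_symm _).comp (Motives.AlgPoints.continuous_map ι)

/-- For a closed immersion `ι`, `hypersurfacePoint ι` is a topological embedding
(`Motives.AlgPoints.isEmbedding_map_of_isClosedImmersion` and the homeomorphism `projPoint`).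
[cite: SerreGAGA1956, §2 n°5 Lemme 1 b)] -/
theorem isEmbedding_hypersurfacePoint (ι : Y ⟶ Motives.projectiveSpace (n + 1) ℂ)
    [IsClosedImmersion ι.left] : IsEmbedding (hypersurfacePoint ι) :=
  (Homeomorph.isEmbedding _).comp (Motives.AlgPoints.isEmbedding_map_of_isClosedImmersion ι)

/-! ### The image: complex points of `V₊(F)` are the projective zeros of `F` -/

section Range

variable {ι : Y ⟶ Motives.projectiveSpace (n + 1) ℂ} {F : MvPolynomial (Fin (n + 2)) ℂ} {d : ℕ}

/-- If `ι(Y) = V₊(F)` then no complex point of `Y` maps into `D₊(F)`. [folklore] -/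
theorem pt_map_notMem_basicOpen
    (hrange : Set.range ι.left.base = ProjectiveSpectrum.zeroLocus 𝓐 {F})
    (P : Motives.ComplexPoints Y) : (Motives.AlgPoints.map ι P).pt ∉ Proj.basicOpen 𝓐 F := by
  have hmem : ι.left.base P.pt ∈ ProjectiveSpectrum.zeroLocus 𝓐 {F} := hrange ▸ mem_range_self _
  have hsub : ({F} : Set (MvPolynomial (Fin (n + 2)) ℂ)) ⊆
      (ι.left.base P.pt : ProjectiveSpectrum 𝓐).asHomogeneousIdeal := hmem
  exact fun h ↦ (Proj.mem_basicOpen 𝓐 F _).mp h (Set.singleton_subset_iff.mp hsub)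

/-- If `ι(Y) = V₊(F)`, `F` homogeneous, then `hypersurfacePoint ι` lands in the projective zero
locus of `F` (`[z] ∈ D₊(F)` iff `F(z) ≠ 0`, `preimage_projPoint_setOf_pt_mem_basicOpen`).
[cite: SerreGAGA1956, §2 n°5] -/
theorem hypersurfacePoint_mem_projZeroLocus (hF : F.IsHomogeneous d)
    (hrange : Set.range ι.left.base = ProjectiveSpectrum.zeroLocus 𝓐 {F})
    (P : Motives.ComplexPoints Y) : hypersurfacePoint ι P ∈ Projectivization.projZeroLocus {F} := by
  by_contra hP
  have : hypersurfacePoint ι P ∈ projPoint (n + 1) ⁻¹' {Q | Q.pt ∈ Proj.basicOpen 𝓐 F} := by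
    rw [preimage_projPoint_setOf_pt_mem_basicOpen (n + 1) F d hF]; exact hP
  exact pt_map_notMem_basicOpen hrange P (by simpa using this)

/-- If `ι` is a closed immersion with `ι(Y) = V₊(F)`, `F` homogeneous, then every projective zero
`[z]` of `F` is `hypersurfacePoint ι P` for some complex point `P` of `Y`: the point of `ℙ^{n+1}_ℂ`
under `projPoint [z]` is a closed point of `V₊(F) = ι(Y)`, i.e. `ι(y)` with `y` closed, and closed
points of the finite-type `ℂ`-scheme `Y` are complex points (`Motives.ComplexPoints.equivClosedPoints`,
Nullstellensatz), complex points of `ℙ^{n+1}_ℂ` being determined by their underlying point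
(`Motives.ComplexPoints.ext_of_pt_eq`). [cite: SerreGAGA1956, §2 n°5] -/
theorem exists_hypersurfacePoint_eq [IsClosedImmersion ι.left] (hF : F.IsHomogeneous d)
    (hrange : Set.range ι.left.base = ProjectiveSpectrum.zeroLocus 𝓐 {F})
    {p : ℙ ℂ (Fin (n + 2) → ℂ)} (hp : p ∈ Projectivization.projZeroLocus {F}) :
    ∃ P : Motives.ComplexPoints Y, hypersurfacePoint ι P = p := by
  haveI : LocallyOfFiniteType Y.hom := by rw [← Over.w ι]; infer_instance
  set Q := projPoint (n + 1) p with hQ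
  -- the underlying point of `Q` lies in `V₊(F) = ι(Y)`
  have hQF : Q.pt ∈ ProjectiveSpectrum.zeroLocus 𝓐 {F} := by
    change ({F} : Set (MvPolynomial (Fin (n + 2)) ℂ)) ⊆ (Q.pt : ProjectiveSpectrum 𝓐).asHomogeneousIdeal
    rw [Set.singleton_subset_iff]
    by_contra hnot
    have hbo : Q.pt ∈ Proj.basicOpen 𝓐 F := (Proj.mem_basicOpen 𝓐 F _).mpr hnot
    have : p ∈ projPoint (n + 1) ⁻¹' {Q | Q.pt ∈ Proj.basicOpen 𝓐 F} := hbo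
    rw [preimage_projPoint_setOf_pt_mem_basicOpen (n + 1) F d hF] at this
    exact this hp
  rw [← hrange] at hQF
  obtain ⟨y, hy⟩ := hQF
  have hyc : IsClosed ({y} : Set Y.left) := by
    have : ({y} : Set Y.left) = ι.left.base ⁻¹' {Q.pt} := by
      ext y'
      simp only [mem_singleton_iff, mem_preimage]
      exact ⟨by rintro rfl; exact hy, fun h ↦ ι.left.isClosedEmbedding.injective (h.trans hy.symm)⟩
    rw [this]
    exact Q.isClosed_pt.preimage ι.left.continuous
  refine ⟨(Motives.ComplexPoints.equivClosedPoints Y).symm ⟨y, hyc⟩,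
    hypersurfacePoint_eq_of_projPoint_eq ι _ (Motives.ComplexPoints.ext_of_pt_eq ?_)⟩
  rw [Motives.AlgPoints.pt_map]
  change Q.pt = ι.left.base _
  have hpt : ((Motives.ComplexPoints.equivClosedPoints Y).symm ⟨y, hyc⟩).pt = y := by
    have := Motives.ComplexPoints.coe_equivClosedPoints_apply Y
      ((Motives.ComplexPoints.equivClosedPoints Y).symm ⟨y, hyc⟩)
    rw [Equiv.apply_symm_apply] at this
    exact this.symm
  rw [hpt, hy]

/-- **The complex points of the embedded hypersurface are the projective zeros of its equation**:
for a closed immersion `ι` with `ι(Y) = V₊(F)`, `F` homogeneous, the image of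
`hypersurfacePoint ι : Y(ℂ) → ℙ ℂ ℂ^{n+2}` is `{[z] | F(z) = 0}`.
[cite: SerreGAGA1956, §2 n°5] -/
theorem range_hypersurfacePoint [IsClosedImmersion ι.left] (hF : F.IsHomogeneous d)
    (hrange : Set.range ι.left.base = ProjectiveSpectrum.zeroLocus 𝓐 {F}) :
    Set.range (hypersurfacePoint ι) = Projectivization.projZeroLocus {F} :=
  Set.Subset.antisymm (by rintro _ ⟨P, rfl⟩; exact hypersurfacePoint_mem_projZeroLocus hF hrange P)
    fun _ hp ↦ exists_hypersurfacePoint_eq hF hrange hp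

end Range

/-! ### Affine charts and coordinates -/

section Charts

variable (ι : Y ⟶ Motives.projectiveSpace (n + 1) ℂ) (i : Fin (n + 2))

/-- The standard affine open `Uᵢ = D₊(Xᵢ) ⊆ ℙ^{n+1}_ℂ`, as the range of the chart immersion
`chartι (n+1) i : Spec ℂ[X]_{(Xᵢ)} ⟶ ℙ^{n+1}_ℂ` (`opensRange_chartι_left`). [folklore] -/
abbrev projChartOpen : (Motives.projectiveSpace (n + 1) ℂ).left.Opens := (chartι (n + 1) i).left.opensRange

/-- `projChartOpen i = D₊(Xᵢ)`. [folklore] -/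
theorem projChartOpen_eq_basicOpen : projChartOpen i = Proj.basicOpen 𝓐 (MvPolynomial.X i) :=
  opensRange_chartι_left (n + 1) i

/-- Membership in `projChartOpen i` is membership in `D₊(Xᵢ)`. [folklore] -/
theorem mem_projChartOpen_iff (x : (Motives.projectiveSpace (n + 1) ℂ).left) :
    x ∈ projChartOpen i ↔ x ∈ Proj.basicOpen 𝓐 (MvPolynomial.X i) := by
  rw [projChartOpen_eq_basicOpen]; exact Iff.rfl

/-- `Uᵢ` is an affine open (range of an open immersion from an affine scheme). [folklore] -/
theorem isAffineOpen_projChartOpen : IsAffineOpen (projChartOpen (n := n) i) :=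
  haveI : IsAffine (chartScheme (n + 1) i).left := inferInstanceAs (IsAffine (Spec _))
  isAffineOpen_opensRange (chartι (n + 1) i).left

/-- A complex point of `Y` maps into `Uᵢ` iff its homogeneous coordinates have `zᵢ ≠ 0`, i.e. iff
`hypersurfacePoint ι P` lies in the domain of the `i`-th standard chart. [folklore] -/
theorem pt_map_mem_projChartOpen_iff (P : Motives.ComplexPoints Y) :
    (Motives.AlgPoints.map ι P).pt ∈ projChartOpen i ↔
      hypersurfacePoint ι P ∈ (Projectivization.stdChart i).source := by
  have key := Set.ext_iff.mp (preimage_projPoint_setOf_pt_mem_basicOpen (n + 1)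
    (MvPolynomial.X i : MvPolynomial (Fin (n + 2)) ℂ) 1 (MvPolynomial.isHomogeneous_X ℂ i))
    (hypersurfacePoint ι P)
  rw [Projectivization.compl_projZeroLocus_X_eq_stdChartSource, mem_preimage, mem_setOf_eq,
    projPoint_hypersurfacePoint] at key
  rw [mem_projChartOpen_iff, Projectivization.stdChart_source]
  exact key

/-- The section `X_k/Xᵢ ∈ Γ(ℙ^{n+1}_ℂ, Uᵢ)`: the coordinate `coordSection (n+1) i k` of the chart
scheme `Spec ℂ[X]_{(Xᵢ)}`, transported along the chart immersion (`Scheme.Hom.appIso ⊤` and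
`f ''ᵁ ⊤ = f.opensRange`). [folklore] -/
def projRatioSection (k : Fin (n + 2)) : Γ((Motives.projectiveSpace (n + 1) ℂ).left, projChartOpen i) :=
  (Motives.projectiveSpace (n + 1) ℂ).left.presheaf.map
    (eqToHom (Scheme.Hom.image_top_eq_opensRange (chartι (n + 1) i).left).symm).op
    (((chartι (n + 1) i).left.appIso ⊤).inv (coordSection (n + 1) i k))

/-- The value of `X_k/Xᵢ` at the point of `ℙ^{n+1}_ℂ` with homogeneous coordinates `z`, `zᵢ ≠ 0`,
is `z_k/zᵢ` (`eval_coordSection_chartPoint` transported along the chart immersion).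
[folklore] -/
theorem eval_projRatioSection_map_chartPoint (k : Fin (n + 2)) (z : Fin (n + 2) → ℂ) (hz : z i ≠ 0)
    (h : (Motives.AlgPoints.map (chartι (n + 1) i) (chartPoint (n + 1) z hz)).pt ∈ projChartOpen i) :
    (Motives.AlgPoints.map (chartι (n + 1) i) (chartPoint (n + 1) z hz)).eval (projChartOpen i) h
      (projRatioSection i k) = z k / z i := by
  rw [projRatioSection, Motives.AlgPoints.eval_presheaf_map, Motives.AlgPoints.eval_map]
  have happ := ConcreteCategory.congr_hom
    (Scheme.Hom.appIso_inv_app (chartι (n + 1) i).left ⊤) (coordSection (n + 1) i k)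
  rw [CategoryTheory.comp_apply] at happ
  have key : ∀ (h'' : (chartPoint (n + 1) z hz).pt ∈ (chartι (n + 1) i).left ⁻¹ᵁ
      ((chartι (n + 1) i).left ''ᵁ ⊤)),
      (chartPoint (n + 1) z hz).eval _ h'' ((chartι (n + 1) i).left.app _
        (((chartι (n + 1) i).left.appIso ⊤).inv (coordSection (n + 1) i k))) = z k / z i := by
    intro h''
    rw [happ, Motives.AlgPoints.eval_presheaf_map, eval_coordSection_chartPoint]
  exact key _

variable [IsClosedImmersion ι.left]

/-- The affine open `ι⁻¹(Uᵢ)` of `Y` (closed immersions are affine morphisms). [folklore] -/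
def hypersurfaceAffineChart : Y.left.affineOpens :=
  ⟨ι.left ⁻¹ᵁ projChartOpen i, (isAffineOpen_projChartOpen i).preimage ι.left⟩

/-- The open underlying `hypersurfaceAffineChart ι i` is `ι⁻¹(Uᵢ)`. [folklore] -/
theorem coe_hypersurfaceAffineChart :
    (↑(hypersurfaceAffineChart ι i) : Y.left.Opens) = ι.left ⁻¹ᵁ projChartOpen i := rfl

/-- A complex point of `Y` lies over `ι⁻¹(Uᵢ)` iff `hypersurfacePoint ι P ∈ Uᵢ`. [folklore] -/
theorem mem_hypersurfaceAffineChart_iff (P : Motives.ComplexPoints Y) :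
    P.pt ∈ (↑(hypersurfaceAffineChart ι i) : Y.left.Opens) ↔
      hypersurfacePoint ι P ∈ (Projectivization.stdChart i).source :=
  pt_map_mem_projChartOpen_iff ι i P

/-- **The complex points of `ι⁻¹(D₊(Xᵢ))` are the preimage of the chart domain `Uᵢ`.**
[cite: SerreGAGA1956, §2 n°5 Prop. 2] -/
theorem setOf_mem_hypersurfaceAffineChart :
    {P : Motives.ComplexPoints Y | P.pt ∈ (↑(hypersurfaceAffineChart ι i) : Y.left.Opens)} =
      hypersurfacePoint ι ⁻¹' (Projectivization.stdChart i).source :=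
  Set.ext fun P ↦ mem_hypersurfaceAffineChart_iff ι i P

/-- The regular function `ι^*(X_{i.succAbove j}/Xᵢ) ∈ Γ(Y, ι⁻¹(Uᵢ))`: the `j`-th affine
coordinate of the `i`-th chart, restricted to `Y`. [folklore] -/
def hypersurfaceCoordFn (j : Fin (n + 1)) : Γ(Y.left, ↑(hypersurfaceAffineChart ι i)) :=
  ι.left.app (projChartOpen i) (projRatioSection i (i.succAbove j))

/-- **The affine coordinates of an embedded scheme are regular functions**: for `P` over
`ι⁻¹(Uᵢ)`, the value of `ι^*(X_k/Xᵢ)` at `P` (`k = i.succAbove j`) is the `j`-th coordinate of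
`hypersurfacePoint ι P` in the `i`-th standard chart, `z_k/zᵢ`. Proof: naturality of evaluation
along `ι` (`Motives.AlgPoints.eval_map`), `ι(P) = projPoint [z]` is the image of the chart point
with homogeneous coordinates `z` (`projPoint_mk_eq_map_chartPoint`), and
`eval_projRatioSection_map_chartPoint`. [cite: SerreGAGA1956, §2 n°5 Lemme 1 c) and Prop. 2] -/
theorem evalOrZero_hypersurfaceCoordFn (j : Fin (n + 1)) (P : Motives.ComplexPoints Y)
    (hP : P.pt ∈ (↑(hypersurfaceAffineChart ι i) : Y.left.Opens)) :
    Motives.AlgPoints.evalOrZero ↑(hypersurfaceAffineChart ι i) (hypersurfaceCoordFn ι i j) P =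
      Projectivization.stdChart i (hypersurfacePoint ι P) j := by
  have hsrc : hypersurfacePoint ι P ∈ (Projectivization.stdChart i).source :=
    (mem_hypersurfaceAffineChart_iff ι i P).mp hP
  -- homogeneous coordinates of `hypersurfacePoint ι P`
  set v := (hypersurfacePoint ι P).rep with hv
  have hv0 : v ≠ 0 := (hypersurfacePoint ι P).rep_nonzero
  have hmk : Projectivization.mk ℂ v hv0 = hypersurfacePoint ι P := Projectivization.mk_rep _
  have hvi : v i ≠ 0 := by
    rw [← hmk, Projectivization.stdChart_source, Projectivization.mk_mem_stdChartSource_iff] at hsrc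
    exact hsrc
  have hmap : Motives.AlgPoints.map ι P =
      Motives.AlgPoints.map (chartι (n + 1) i) (chartPoint (n + 1) v hvi) := by
    rw [← projPoint_hypersurfacePoint, ← hmk]
    exact projPoint_mk_eq_map_chartPoint (n + 1) v hvi
  rw [Motives.AlgPoints.evalOrZero_of_mem _ hP]
  have hP' : (Motives.AlgPoints.map ι P).pt ∈ projChartOpen i := hP
  have step1 : P.eval (↑(hypersurfaceAffineChart ι i)) hP (hypersurfaceCoordFn ι i j) =
      (Motives.AlgPoints.map ι P).eval (projChartOpen i) hP' (projRatioSection i (i.succAbove j)) :=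
    (Motives.AlgPoints.eval_map ι P (projChartOpen i) hP' _).symm
  have h' : (Motives.AlgPoints.map (chartι (n + 1) i) (chartPoint (n + 1) v hvi)).pt ∈
      projChartOpen i := by
    rw [← hmap]; exact hP'
  have step2 : (Motives.AlgPoints.map ι P).eval (projChartOpen i) hP'
      (projRatioSection i (i.succAbove j)) =
      (Motives.AlgPoints.map (chartι (n + 1) i) (chartPoint (n + 1) v hvi)).eval (projChartOpen i) h'
        (projRatioSection i (i.succAbove j)) := by
    congr 1
  rw [step1, step2, eval_projRatioSection_map_chartPoint, ← hmk, Projectivization.stdChart_apply,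
    Projectivization.stdChartFun_mk]

end Charts

/-! ### Package -/

/-- **Complex points and homogeneous coordinates of an embedded hypersurface** (proved; GAGA
bookkeeping, Serre GAGA §2 n°5). Let `ι : Y ⟶ ℙ^{n+1}_ℂ` be a closed immersion whose image is
`V₊(F)`, `F` homogeneous of degree `d`. Then, with `ψ = hypersurfacePoint ι : Y(ℂ) → ℙ ℂ ℂ^{n+2}`:
(i) `ψ` is a topological embedding; (ii) its image is `{[z] | F(z) = 0}`; (iii) for each `i` there
is an affine open `U ⊆ Y` (namely `ι⁻¹(D₊(Xᵢ))`) whose complex points are `ψ⁻¹(Uᵢ)` and regular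
functions `s_j ∈ Γ(Y, U)` (namely `ι^*(X_{i.succAbove j}/Xᵢ)`) whose values are the affine
coordinates of `ψ` in the `i`-th standard chart. [cite: SerreGAGA1956, §2 n°5 Lemme 1 and Prop. 2] -/
theorem hypersurface_complexPoints (ι : Y ⟶ Motives.projectiveSpace (n + 1) ℂ)
    {F : MvPolynomial (Fin (n + 2)) ℂ} {d : ℕ} (hF : F.IsHomogeneous d) [IsClosedImmersion ι.left]
    (hrange : Set.range ι.left.base = ProjectiveSpectrum.zeroLocus 𝓐 {F}) :
    IsEmbedding (hypersurfacePoint ι) ∧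
      Set.range (hypersurfacePoint ι) = Projectivization.projZeroLocus {F} ∧
      ∀ i : Fin (n + 2), ∃ U : Y.left.affineOpens,
        {P : Motives.ComplexPoints Y | P.pt ∈ (↑U : Y.left.Opens)} =
          hypersurfacePoint ι ⁻¹' (Projectivization.stdChart i).source ∧
        ∀ j : Fin (n + 1), ∃ s : Γ(Y.left, ↑U), ∀ P : Motives.ComplexPoints Y,
          P.pt ∈ (↑U : Y.left.Opens) →
            Motives.AlgPoints.evalOrZero ↑U s P = Projectivization.stdChart i (hypersurfacePoint ι P) j :=
  ⟨isEmbedding_hypersurfacePoint ι, range_hypersurfacePoint hF hrange, fun i ↦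
    ⟨hypersurfaceAffineChart ι i, setOf_mem_hypersurfaceAffineChart ι i, fun j ↦
      ⟨hypersurfaceCoordFn ι i j, evalOrZero_hypersurfaceCoordFn ι i j⟩⟩⟩

end Literature.AlgebraicGeometry.HodgeTheory

end
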